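import Literature.AlgebraicGeometry.AbelianSchemes.PDivisibleGroupBlockDocking          -- ★ (O-DOCK) `exists_blockDocking`, `forall_mem_comp_i_eq_one_iff_exists_comp_ιA`
import Literature.AlgebraicGeometry.AbelianSchemes.PDivisibleGroupBlockCotangentRank    -- ★ DEAL 6 `htan_hdim_block_of_lieSignature`
import Literature.AlgebraicGeometry.GroupSchemes.BTGroupFrobeniusKernelInCoordinates   -- ★ (FKw) `finrank_alg_ker_relFrobeniusOver`, `BTGroup.exists_fac_of_finrank_alg_le`
import Literature.AlgebraicGeometry.GroupSchemes.FrobeniusKernelUnitComponent         -- ★ K1 `exists_iso_ker_relFrobeniusOver_unitComponent`, layer criterion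
import Literature.AlgebraicGeometry.GroupSchemes.BTGroupConnectedDimOneOfTangentRank   -- ★ PRODUCER `BTGroup.isConnectedDimOne_of_finrank_cotangent_le_one`
import Literature.AlgebraicGeometry.GroupSchemes.UnitComponentOfFiniteGroupScheme     -- ★ (b1a) `exists_unitComponent`
import Literature.AlgebraicGeometry.GroupSchemes.UnitComponentOfKernel              -- ★ N1b `BTGroup.exists_hom_kernel_app_one_of_unitComponent`
import Literature.AlgebraicGeometry.GroupSchemes.BarsottiTateGroupConnectedPart        -- ★ N1 `BTGroup.exists_connectedPart_ringAction`
import Literature.AlgebraicGeometry.GroupSchemes.BarsottiTateGroupConnectedPartTangent -- ★ N1c `BTGroup.pos_height_and_finrank_cotangent_le_of_unitComponent`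
import Literature.AlgebraicGeometry.GroupSchemes.UniformizerKernelMonogenic            -- ★ N2 `UniformizerKernel.exists_algEquiv_quotient_X_pow_of_uniformizerKernel`
import Literature.AlgebraicGeometry.GroupSchemes.BarsottiTateGroupTorsionLayers        -- ★ `BTGroup.transition`, `isClosedImmersion_transition_left`
import Literature.AlgebraicGeometry.Motives.AbelianVarietyFrobeniusKernelBlocks        -- ★ (BLK) `isMonHom_relFrobeniusOver`
import Literature.RingTheory.DedekindDomain.BlockIdempotentFamily                      -- ★ (O-CRT) §4 numerics of `Localization.AtPrime w`
import Mathlib.RingTheory.DedekindDomain.Dvr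
import HarnessLib

/-!
# Frobenius saturation of a one-dimensional block: the `F_q`-kernel of every layer lies in the first `𝔭`-layer
# ([Tate 1967] §2.2; [Harris–Taylor 2001] §II.1–II.2; [Liu 2021] App. D p. 137)

Topic `Literature/AlgebraicGeometry/AbelianSchemes`; namespaces `Literature.AlgebraicGeometry.GroupSchemes` (§1–§2, Barsotti–Tate currency) and
`Literature.AlgebraicGeometry.AbelianSchemes.AbelianSchemeOver.RingAction` (§3–§4, abelian-scheme currency).  THEOREMS ONLY (no definition, no named
fact, no instance, no notation, no `sorry`).  Cell `hodgecm-mathlib` (D-0151), FLOOR 0, P6 «MOD programme» (crux hLiu418 = stmt-HodgeConjecture-24832,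
`--supports`, count-neutral): organ **(hsat) «FROBENIUS SATURATION OF THE `c•w` BLOCK»** of line L3 (socket `stub_FROB`; LA3-plan (g2) STATUS #2
2026-09-02T06:34Z, binder `hsat` of A-p03 (g31)'s (R3) glue `F0P6aRoofCwKernel` ∕ LA1-p03 (g3)'s (rL-asm) assembly at `x̄`): for the reduction `A = 𝒜_x̄` of
the universal abelian scheme at a special point, with its `𝒪_F`-action `ι` and the block place `𝔭 = 𝔭_{c•w}` (`q = p^f = #𝒪_F∕𝔭`),
**a `T`-point of `A` killed by `𝔭ⁿ` and by the `q`-Frobenius `F_{A∕k}^{(f)}` is killed by `𝔭`** — `Ker F_q ∩ A[𝔭^∞] ⊆ A[𝔭]`.  This is the one place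
where the (rL) law of the roof uses that the `c•w`-block of `A[p^∞]` is ONE-DIMENSIONAL (Kottwitz signature `1` at `c•w`); it is real content as soon as
`q ≠ p` or `𝔭` is ramified ([Liu2021] p. 137: «`E_∞|_T` has dimension 1 and `O_𝔭`-height 2»).  HC_CM is proved only modulo the printed citations
(2 remaining named inputs hLiu418 24832, h413 24833) until rung 0 closes; this file is generic and changes no count.

THE MATHEMATICS.  Let `𝒢` be a Barsotti–Tate group over an algebraically closed field `k ⊇ 𝔽_p` with a ring action `β` of a DVR `𝒪` (residue field of
cardinality `q = p^f`, uniformiser `ϖ`, `ϖ^e ~ p`), ONE-DIMENSIONAL (unit cotangent spaces of the layers of rank `≤ 1`, layer `1` non-zero), and let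
`G = 𝒢₁[ϖ] ↪ 𝒢₁` be the `[ϖ]`-kernel socket of the ★ P6b kit `blockNumerics_of_line`.  The connected part `𝒢⁰` ([Tate1967] (2.4); ★ N1) is a connected
one-dimensional BT group, so `Γ(𝒢⁰ₙ) ≃ k[X]⧸(X^{p^{nH₀}})` ([Tate1967] §2.2; ★ PRODUCER) and its closed subschemes are the `V(x^j)`, NESTED BY RANK (★ (FKw)).
The Frobenius kernel `Ker F_q|_{𝒢ₙ}` is infinitesimal, hence equals `Ker F_q|_{𝒢⁰ₙ} = V(x^{min(q, p^{nH₀})})` ([SGA3I] VII_A 4.1–4.3; ★ K1), of rank `≤ q`;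
the unit component `U = G⁰ ≅ 𝒢⁰₁[ϖ]` is `Spec k[X]⧸(X^{q^h})` with `h ≥ 1` the `𝒪`-height of `𝒢⁰` ([HarrisTaylorAMS2001] §II.1–II.2; ★ N1b, ★ N2), a closed
subscheme of `𝒢⁰ₙ` (through the transition `𝒢⁰₁ ↪ 𝒢⁰ₙ`) of rank `q^h ≥ q`.  Hence `Ker F_q|_{𝒢ₙ} ⊆ U ⊆ G` inside `𝒢ₙ` (§2).  For an abelian scheme
`A → Spec k` with a ring action of a Dedekind domain `O` and a maximal ideal `w ∋ p`, `#O∕w = p^f`, the `w`-block `𝒢 := Fix ε_w ⊂ A[p^∞]`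
([RapoportSmithlingZhang2020Diagonal] §4.1 p. 17; ★ (O-DOCK)) receives every `T`-point of `A` killed by `wⁿ ∋ pⁿ` (it is `pⁿ`-torsion and fixed by
`ε_w`, whose `n`-th layer is `ι(aₙ)` with `aₙ ≡ 1 (mod w^{en})`), the relative Frobenius of `A` restricts to that of the layer ([SGA3I] VII_A 4.1; ★ (BLK)∕K1
layer criterion), and `G`-points are exactly the `w`-torsion points (★ (O-DOCK) `hkerA`) — §3–§4, with the block's one-dimensionality fed by the Lie
signature of `e_w` exactly as in ★ P6d `blockDocking_of_line` (★ DEAL 6).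

* §1 `BTGroup.Hom.app_comp_transition` — homomorphisms of BT groups commute with all transitions `i_{n,m}`.
* §2 **`BTGroup.exists_fac_uniformizerKernel_of_comp_relFrobeniusOver_eq_one`** — KIT-SOCKET form (sockets of ★ `blockNumerics_of_line` minus `hH`): a
  `T`-point of `𝒢ₙ` (`n ≥ 1`) killed by `F_q` factors through `G ↪ 𝒢₁ ↪ 𝒢ₙ`.
* §3 `exists_comp_fixBTGroupι_comp_torsionι_of_forall_mem_pow` — «killed by `wⁿ` ⇒ a point of `(Fix ε_w)ₙ`», the layer-`n` twin of ★ (O-J) §1∕§3∕§5;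
  `fixBTGroupι_app_comp_transition_comp_torsionι` (bookkeeping `(Fix ε)₁ ↪ (Fix ε)ₙ ↪ A[pⁿ] ↪ A = (Fix ε)₁ ↪ A[p] ↪ A`).
* §4 **`forall_comp_i_eq_one_of_forall_mem_pow_of_comp_relFrobeniusOver_eq_one`** — the A-CURRENCY HEAD with the binders of ★ P6d
  `blockDocking_of_line` VERBATIM (`hg act w hw0 hpw hf he hx hcop a ha1 ha2 hrank hsig`):
  `(∀ b ∈ w ^ n, x ≫ act.i b = 1) → x ≫ relFrobeniusOver p f A.X = 1 → ∀ b ∈ w, x ≫ act.i b = 1`.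

## References
* [Tate1967] J. T. Tate, *p-divisible groups*, Proc. Conf. Local Fields (Driebergen, 1966), Springer (1967) — §2 (2.1), (2.2), (2.4).
* [HarrisTaylorAMS2001] M. Harris, R. Taylor, *The geometry and cohomology of some simple Shimura varieties*, Ann. of Math. Stud. 151 (2001) — §II.1 (p. 59), §II.2.
* [SGA3I] M. Demazure, A. Grothendieck (eds.), *SGA 3, Tome I*, Exp. VII_A §4, 4.1–4.3 (relative Frobenius, its kernel).
* [RapoportSmithlingZhang2020Diagonal] M. Rapoport, B. Smithling, W. Zhang, *Arithmetic diagonal cycles on unitary Shimura varieties*, Compos. Math. 156 (2020) — §4.1 (p. 17).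
* [Liu2021] Y. Liu, *Fourier–Jacobi cycles and arithmetic relative trace formula*, Camb. J. Math. 9 (2021) — App. D, Prop. D.8 (3) p. 135, pp. 136–137.
* [Tate1997FiniteFlatGroupSchemes] J. Tate, *Finite flat group schemes*, in: Modular Forms and Fermat's Last Theorem (1997) — (3.7).
-/

set_option autoImplicit false

noncomputable section

universe u v w

open CategoryTheory CategoryTheory.Limits AlgebraicGeometry MonoidalCategory CartesianMonoidalCategory
open Polynomial
open scoped MonObj Obj

namespace Literature.AlgebraicGeometry.GroupSchemes

open Literature.AlgebraicGeometry.Motives (SchemeOver relFrobeniusOver frobeniusTwistOver isMonHom_relFrobeniusOver)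
open AffineGroupScheme (Alg)
open GroupSchemeKernel (ker kerι kerLift kerLift_ι)

/-! ## §1 Homomorphisms of Barsotti–Tate groups commute with all transitions -/

section Transition

variable {S : Scheme.{u}} {p h h' : ℕ} {B : BTGroup S p h} {B' : BTGroup S p h'}

/-- **A homomorphism of Barsotti–Tate groups commutes with every transition `i_{n,m}`**: `φ_n ≫ i'_{n,m} = i_{n,m} ≫ φ_m` (the axiom
`incl_comp_app` iterated). [cite: Tate1967, §2 (2.1)] -/
theorem BTGroup.Hom.app_comp_transition (φ : BTGroup.Hom B B') {n m : ℕ} (hnm : n ≤ m) :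
    φ.app n ≫ B'.transition hnm = B.transition hnm ≫ φ.app m := by
  induction m, hnm using Nat.le_induction with
  | base => rw [BTGroup.transition_self, BTGroup.transition_self, Category.comp_id, Category.id_comp]
  | succ m hnm ih =>
    rw [B'.transition_succ_right hnm, B.transition_succ_right hnm, ← Category.assoc, ih, Category.assoc, Category.assoc,
      φ.incl_comp_app]

end Transition

/-! ## §2 KIT-SOCKET FORM: the `F_q`-kernel of every layer of a one-dimensional BT `𝒪`-module lies in the `[ϖ]`-kernel of layer `1` -/

section BT

variable {k : Type u} [Field k] [IsAlgClosed k] (p f : ℕ) [Fact p.Prime] [CharP k p] [ExpChar k p]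

-- as in ★ (FKw) ∕ ★ K1: statements of the shape `s ≫ F_q = 1` need the slow `One (T ⟶ G^{(q)})` instance search through the transported structure.
set_option synthInstance.maxHeartbeats 400000 in
set_option maxHeartbeats 800000 in
/-- **`Ker F_q|_{𝒢ₙ} ⊆ 𝒢₁[ϖ]` FOR A ONE-DIMENSIONAL BARSOTTI–TATE `𝒪`-MODULE** (kit-socket form; sockets = ★ `blockNumerics_of_line`'s minus `hH`).
INPUT: a BT group `B` over `k = k̄` of characteristic `p` with a ring action `β` of a DVR `𝒪` (`#(𝒪∕𝔪) = p^f`, uniformiser `ϖ`, `ϖ^e ~ p`, `e ≥ 1`),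
one-dimensional (`htan`, `hdim`), and the `[ϖ]`-layer socket `(G, ιG, hker)` («`ιG : G ↪ B.G 1` is a closed subgroup through which exactly the
points killed by `(β ϖ)₁` factor»).  OUTPUT: for `n ≥ 1`, every `T`-point `s` of `B.G n` with `s ≫ F^{(f)}_{B.G n∕k} = 1` factors through
`ιG ≫ i_{1,n}`.  Route: connected part `B⁰` (★ N1) is connected of dimension one (★ N1c, ★ PRODUCER); `Ker F_q|_{B.G n} = Ker F_q|_{B⁰.G n}` (★ K1) has rank
`min(q, p^{nH₀}) ≤ q` (★ (FKw)); the unit component `U` of `G` is `B⁰.G 1[ϖ] ≅ Spec k[X]⧸(X^{q^h})`, `h ≥ 1` (★ (b1a), ★ N1b, ★ N2), a closed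
subscheme of `B⁰.G n` of rank `≥ q`; closed subschemes of `B⁰.G n` are nested by rank (★ (FKw)). [cite: Tate1967, §2.2 and (2.4)]
[cite: HarrisTaylorAMS2001, §II.1 p. 59, §II.2] [cite: SGA3I, VII_A 4.1–4.3] -/
theorem BTGroup.exists_fac_uniformizerKernel_of_comp_relFrobeniusOver_eq_one
    (𝒪 : Type v) [CommRing 𝒪] [IsDomain 𝒪] [IsDiscreteValuationRing 𝒪] [Finite (IsLocalRing.ResidueField 𝒪)]
    (hq : Nat.card (IsLocalRing.ResidueField 𝒪) = p ^ f) (ϖ : 𝒪) (hϖ : Irreducible ϖ)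
    (e : ℕ) (he : 0 < e) (hpe : Associated (ϖ ^ e) (p : 𝒪))
    {H : ℕ} (B : BTGroup (Spec (.of k)) p H)
    (β : 𝒪 → BTGroup.Hom B B) (hβ : IsRingActionBT B β)
    (htan : ∀ n, letI := B.grpObj n;
      Module.finrank k (RingHom.ker ((η[B.G n] : 𝟙_ (SchemeOver k) ⟶ B.G n).left.appTop.hom) : Ideal (Alg (B.G n))).Cotangent ≤ 1)
    (hdim : letI := B.grpObj 1;
      Module.finrank k (RingHom.ker ((η[B.G 1] : 𝟙_ (SchemeOver k) ⟶ B.G 1).left.appTop.hom) : Ideal (Alg (B.G 1))).Cotangent ≠ 0)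
    (G : SchemeOver k) [GrpObj G] [IsAffine G.left] [IsFinite G.hom] (ιG : G ⟶ B.G 1)
    (hιG : letI := B.grpObj 1; IsMonHom ιG ∧ IsClosedImmersion ιG.left)
    (hker : letI := B.grpObj 1; ∀ ⦃T : SchemeOver k⦄ (t : T ⟶ B.G 1), t ≫ (β ϖ).app 1 = 1 ↔ ∃ s : T ⟶ G, s ≫ ιG = t)
    {n : ℕ} (hn : 1 ≤ n) {T : SchemeOver k} (s : T ⟶ B.G n)
    (hs : letI := B.grpObj n; s ≫ relFrobeniusOver p f (B.G n) = 1) :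
    ∃ g : T ⟶ G, g ≫ ιG ≫ B.transition hn = s := by
  have hp : p.Prime := Fact.out
  letI := B.grpObj n
  letI := B.grpObj 1
  -- ★ N1: the connected part `B₀` with the restricted action `β₀`
  obtain ⟨H₀, B₀, ι₀, β₀, -, hι₀, hβ₀, hcomp⟩ := BTGroup.exists_connectedPart_ringAction B β hβ
  -- ★ N1c + ★ PRODUCER: `B₀` has positive height and is connected of dimension one
  obtain ⟨hH₀, htan₀⟩ := BTGroup.pos_height_and_finrank_cotangent_le_of_unitComponent p B B₀ ι₀ hι₀ htan hdim
  have hC : IsConnectedDimOne B₀ :=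
    BTGroup.isConnectedDimOne_of_finrank_cotangent_le_one B₀ (fun m => (hι₀ m).2.2) htan₀
  -- ★ (b1a): a unit component `U` of `G`; ★ N1b: it is the kernel of `β₀ ϖ` on `B₀.G 1`
  obtain ⟨U, instU, jU, hU⟩ := exists_unitComponent k G
  haveI : IsAffineHom U.hom := by rw [← Over.w jU]; haveI := hU.2.2.1; infer_instance
  haveI : IsAffine U.left := AffineGroupScheme.isAffine_left_of_isAffineHom U
  obtain ⟨u, hu, huι, hkerU⟩ := BTGroup.exists_hom_kernel_app_one_of_unitComponent p B B₀ ι₀ (hι₀ 1) (β ϖ) (β₀ ϖ) (hcomp ϖ)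
    G ιG hιG hker U jU hU
  -- ★ N2: `Γ(U) ≃ k[X]⧸(X^{q^h})`, `h ≥ 1`
  have hpdvd : ∃ e : ℕ, (p : 𝒪) ∣ ϖ ^ e := ⟨e, hpe.symm.dvd⟩
  have hϖp : ϖ ∣ (p : 𝒪) := (dvd_pow_self ϖ he.ne').trans hpe.dvd
  obtain ⟨h, hh, ⟨ψ⟩⟩ := UniformizerKernel.exists_algEquiv_quotient_X_pow_of_uniformizerKernel p f 𝒪 ϖ B₀ hC hH₀ hϖ hpdvd hϖp hq
    β₀ hβ₀ U u hu hkerU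
  have hrkU : Module.finrank k (Alg U) = p ^ (f * h) := finrank_eq_of_algEquiv_quotient_X_pow ψ
  -- the layer-`n` unit component `ι₀.app n : B₀.G n ↪ B.G n` and the Frobenius kernels
  letI := B₀.grpObj n
  letI := B₀.grpObj 1
  haveI := ι₀.isMonHom_app n
  haveI : IsOpenImmersion (ι₀.app n).left := (hι₀ n).1
  haveI : IsClosedImmersion (ι₀.app n).left := (hι₀ n).2.1
  haveI := B.isFinite n
  haveI := B₀.isFinite n
  haveI : IsSeparated (B.G n).hom := inferInstance
  -- ★ K1: `Ker F_q|_{B₀.G n} ≅ Ker F_q|_{B.G n}` over `ι₀.app n`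
  obtain ⟨eK, heK⟩ := exists_iso_ker_relFrobeniusOver_unitComponent p f (ι₀.app n)
  have hιK : kerι (relFrobeniusOver p f (B.G n)) = eK.inv ≫ kerι (relFrobeniusOver p f (B₀.G n)) ≫ ι₀.app n := by
    rw [← heK, eK.inv_hom_id_assoc]
  -- ★ (FKw): `rk Ker F_q|_{B₀.G n} = min(q, p^{nH₀}) ≤ q ≤ q^h = rk U`, and closed subschemes of `B₀.G n` are nested by rank
  haveI := isClosedImmersion_kerι_relFrobeniusOver_left p f (G := B₀.G n)
  haveI : IsClosedImmersion u.left := hu.2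
  haveI := B₀.isClosedImmersion_transition_left hn
  haveI : IsClosedImmersion (u ≫ B₀.transition hn).left := by rw [Over.comp_left]; infer_instance
  have hrk : Module.finrank k (Alg (ker (relFrobeniusOver p f (B₀.G n)))) ≤ Module.finrank k (Alg U) := by
    have ψn : Alg (B₀.G n) ≃ₐ[k] (k[X] ⧸ Ideal.span {(X : k[X]) ^ (p ^ (n * H₀))}) := (hC n).some
    rw [finrank_alg_ker_relFrobeniusOver p f ψn (B₀.pow_ne_zero_of_isConnectedDimOne hC n), hrkU]
    exact (min_le_left _ _).trans (Nat.pow_le_pow_right hp.pos (Nat.le_mul_of_pos_right f hh))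
  obtain ⟨φ, hφ⟩ := B₀.exists_fac_of_finrank_alg_le n hC (kerι (relFrobeniusOver p f (B₀.G n))) (u ≫ B₀.transition hn) hrk
  -- assembly: `s = lift ≫ ι_{Ker} = lift ≫ eK⁻¹ ≫ φ ≫ u ≫ i⁰_{1,n} ≫ ι₀_n = (lift ≫ eK⁻¹ ≫ φ ≫ jU) ≫ ιG ≫ i_{1,n}`
  haveI := isMonHom_relFrobeniusOver p f (B.G n)
  refine ⟨kerLift s hs ≫ eK.inv ≫ φ ≫ jU, ?_⟩
  have h1 : jU ≫ ιG ≫ B.transition hn = u ≫ B₀.transition hn ≫ ι₀.app n := by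
    rw [← Category.assoc, ← huι, Category.assoc, ι₀.app_comp_transition hn]
  simp only [Category.assoc]
  rw [h1, reassoc_of% hφ, ← hιK]
  exact kerLift_ι s hs

end BT

end Literature.AlgebraicGeometry.GroupSchemes


namespace Literature.AlgebraicGeometry.AbelianSchemes.AbelianSchemeOver.RingAction

open Literature.AlgebraicGeometry.AbelianSchemes Literature.AlgebraicGeometry.AbelianSchemes.AbelianSchemeOver
open Literature.AlgebraicGeometry.GroupSchemes Literature.AlgebraicGeometry.GroupSchemes.GroupSchemeKernel
open Literature.AlgebraicGeometry.GroupSchemes.BTGroup Literature.AlgebraicGeometry.GroupSchemes.BTGroup.Hom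
open Literature.AlgebraicGeometry.GroupSchemes.IsRingActionBT
open Literature.AlgebraicGeometry.Motives (SchemeOver relFrobeniusOver frobeniusTwistOver isMonHom_relFrobeniusOver)
open Literature.AlgebraicGeometry.Motives.AbelianVariety (cotangentMap)
open Literature.RingTheory.DedekindDomain

/-- Composition of homomorphisms with the `MonObj` structures as implicit (non-instance) arguments — term-mode glue across the definitional seam
`(A[p^∞])ₙ` vs `A[pⁿ]` (as in ★ (O-DOCK)). [folklore] -/
private theorem isMonHom_comp_of_isMonHom' {C : Type*} [Category C] [CartesianMonoidalCategory C] {M N N' : C} {iM : MonObj M} {iN : MonObj N}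
    {iN' : MonObj N'} {f : M ⟶ N} {g' : N ⟶ N'} (hf : IsMonHom f) (hg : IsMonHom g') : IsMonHom (f ≫ g') :=
  instIsMonHomComp f g'

/-! ## §3 Abelian-scheme side: points killed by `wⁿ` live on the `n`-th layer of the `w`-block; transition bookkeeping -/

section ASide

variable {k : Type u} [Field k] {p : ℕ} {A : AbelianSchemeOver (Spec (.of k))} [IsCommMonObj A.X] {g : ℕ} (hp : p ≠ 0)
  (hg : A.IsOfRelDim g) {O : Type v} [CommRing O] (act : RingAction O A)
  (w : Ideal O) {e : ℕ} {𝔟 : Ideal O} (hx : Ideal.span {(p : O)} = w ^ e * 𝔟) (hcop : w ⊔ 𝔟 = ⊤)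
  (a : ℕ → O) (ha1 : ∀ n, a n - 1 ∈ w ^ (e * n)) (ha2 : ∀ n, a n ∈ 𝔟 ^ n) (h₁ : ℕ)
  (hrank : ∀ n (s : Spec (.of k)), (((isRingActionBT_pDivisibleGroupMap act hp hg).homOfCompatibleFamily a (sub_mem_span_pow hx hcop ha1 ha2)).fixLayer n).hom.finrank s = p ^ (n * h₁))

/-- **DOWN TO THE `n`-TH LAYER** (layer-`n` twin of ★ (O-J) §5): `p ∈ w`, so a `T`-point `t` of `A` killed by every `act.i r`, `r ∈ wⁿ`, is killed by
`[pⁿ] = act.i (pⁿ)` and factors (uniquely) through `A[pⁿ] = (A[p^∞])ₙ` (★ `torsionLift`); its lift is killed by every `(act.i r)[p^∞]ₙ`, `r ∈ wⁿ`.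
[cite: Tate1967, §2 (2.1)–(2.2)] [cite: RapoportSmithlingZhang2020Diagonal, §4.1 (p. 17)] -/
theorem exists_torsionLift_forall_comp_app_eq_one_of_mem_pow (hpw : (p : O) ∈ w) (n : ℕ) {T : Over (Spec (.of k))} (t : T ⟶ A.X)
    (ht : ∀ r ∈ w ^ n, t ≫ act.i r = 1) :
    ∃ tₙ : T ⟶ (A.pDivisibleGroup hp hg).G n, tₙ ≫ A.torsionι (p ^ n) = t ∧
      ∀ r ∈ w ^ n, tₙ ≫ (haveI := act.isMonHom_i r; pDivisibleGroupMap (act.i r) hp hg hg).app n =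
        (letI := (A.pDivisibleGroup hp hg).grpObj n; (1 : T ⟶ (A.pDivisibleGroup hp hg).G n)) := by
  -- `t ≫ [pⁿ] = t ≫ act.i (pⁿ) = 1`
  have htp : t ≫ A.mulN (p ^ n) = 1 := by
    have h := ht ((p : O) ^ n) (Ideal.pow_mem_pow hpw n)
    rw [← Nat.cast_pow, ← Nat.smul_one_eq_cast, act.i_nsmul, act.i_one] at h
    rwa [mulN_def]
  refine ⟨A.torsionLift t htp, A.torsionLift_ι t htp, fun r hr => ?_⟩
  haveI := act.isMonHom_i r
  letI := A.torsionGrpObj (p ^ n)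
  haveI : IsMonHom (A.torsionι (p ^ n)) := A.isMonHom_torsionι (p ^ n)
  show A.torsionLift t htp ≫ torsionMap (act.i r) (p ^ n) = (1 : T ⟶ A.torsion (p ^ n))
  apply A.torsion_hom_ext
  rw [Category.assoc, torsionMap_ι, ← Category.assoc, A.torsionLift_ι t htp, ht r hr, MonObj.one_comp]

include ha1 in
/-- **KILLED BY `wⁿ` ⟹ A POINT OF THE `n`-TH LAYER OF THE `w`-BLOCK** (layer-`n` twin of ★ (O-J) §1 + §3): for `e > 0` the block idempotent family has
`aₙ ≡ 1 (mod w^{en})`, `w^{en} ⊆ wⁿ`, so the lift `tₙ` of §3's first lemma is FIXED by `εₙ = β(aₙ)ₙ = β(aₙ − 1)ₙ · β(1)ₙ` and factors through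
`(Fix ε)ₙ ↪ A[pⁿ]` (★ `IdempotentSplitting.fixLift`): `t = s ≫ ιₙ ≫ (A[pⁿ] ↪ A)`. [cite: Tate1967, §2 (2.1)–(2.2)]
[cite: RapoportSmithlingZhang2020Diagonal, §4.1 (p. 17)] [cite: GortzWedhorn2020, Definition 4.45 (2) (p. 117)] -/
theorem exists_comp_fixBTGroupι_app_comp_torsionι_of_forall_mem_pow (he : 0 < e) (hpw : (p : O) ∈ w) (n : ℕ)
    {T : Over (Spec (.of k))} (t : T ⟶ A.X) (ht : ∀ r ∈ w ^ n, t ≫ act.i r = 1) :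
    ∃ s : T ⟶ (((isRingActionBT_pDivisibleGroupMap act hp hg).homOfCompatibleFamily a (sub_mem_span_pow hx hcop ha1 ha2)).fixBTGroup ((isRingActionBT_pDivisibleGroupMap act hp hg).homOfCompatibleFamily_idem a (sub_mem_span_pow hx hcop ha1 ha2) (mul_self_sub_mem_span_pow hx hcop ha1 ha2)) h₁ hrank).G n, s ≫ (((isRingActionBT_pDivisibleGroupMap act hp hg).homOfCompatibleFamily a (sub_mem_span_pow hx hcop ha1 ha2)).fixBTGroupι ((isRingActionBT_pDivisibleGroupMap act hp hg).homOfCompatibleFamily_idem a (sub_mem_span_pow hx hcop ha1 ha2) (mul_self_sub_mem_span_pow hx hcop ha1 ha2)) h₁ hrank).app n ≫ A.torsionι (p ^ n) = t := by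
  obtain ⟨tₙ, htₙ, htₙw⟩ := exists_torsionLift_forall_comp_app_eq_one_of_mem_pow hp hg act w hpw n t ht
  letI := (A.pDivisibleGroup hp hg).grpObj n
  -- `aₙ − 1 ∈ w^{en} ⊆ wⁿ`
  have hnw : a n - 1 ∈ w ^ n := Ideal.pow_le_pow_right (Nat.le_mul_of_pos_left n he) (ha1 n)
  -- `tₙ` is fixed by `εₙ = β(aₙ)ₙ`
  have hfix : tₙ ≫ ((isRingActionBT_pDivisibleGroupMap act hp hg).homOfCompatibleFamily a (sub_mem_span_pow hx hcop ha1 ha2)).app n = tₙ := by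
    rw [homOfCompatibleFamily_app, ← sub_add_cancel (a n) 1, (isRingActionBT_pDivisibleGroupMap act hp hg).app_add' (a n - 1) 1 n,
      MonObj.comp_mul, htₙw _ hnw, one_mul, (isRingActionBT_pDivisibleGroupMap act hp hg).app_one, Category.comp_id]
  refine ⟨IdempotentSplitting.fixLift (((isRingActionBT_pDivisibleGroupMap act hp hg).homOfCompatibleFamily a (sub_mem_span_pow hx hcop ha1 ha2)).app n) tₙ hfix, ?_⟩
  rw [fixBTGroupι_app, ← Category.assoc]
  change (IdempotentSplitting.fixLift (((isRingActionBT_pDivisibleGroupMap act hp hg).homOfCompatibleFamily a (sub_mem_span_pow hx hcop ha1 ha2)).app n) tₙ hfix ≫ IdempotentSplitting.fixι (((isRingActionBT_pDivisibleGroupMap act hp hg).homOfCompatibleFamily a (sub_mem_span_pow hx hcop ha1 ha2)).app n)) ≫ A.torsionι (p ^ n) = t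
  rw [IdempotentSplitting.fixLift_ι, htₙ]

/-- The transitions of `A[p^∞]` are compatible with the inclusions into `A`: `i_{n,m} ≫ (A[p^m] ↪ A) = (A[pⁿ] ↪ A)` (★ `pDivisibleGroup_incl`,
★ `torsionIncl_ι`, iterated). [cite: Tate1967, §2 (2.1)] -/
theorem pDivisibleGroup_transition_comp_torsionι {n m : ℕ} (hnm : n ≤ m) :
    (A.pDivisibleGroup hp hg).transition hnm ≫ A.torsionι (p ^ m) = A.torsionι (p ^ n) := by
  induction m, hnm using Nat.le_induction with
  | base => rw [BTGroup.transition_self]; exact Category.id_comp _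
  | succ m hnm ih =>
    -- the transition `incl m` of `A[p^∞]` is `torsionIncl` (definitional seam `(A[p^∞])ₘ = A[p^m]`, closed by `exact`)
    have h : (A.pDivisibleGroup hp hg).incl m ≫ A.torsionι (p ^ (m + 1)) = A.torsionι (p ^ m) := by
      rw [pDivisibleGroup_incl]; exact A.torsionIncl_ι _ _ _
    rw [(A.pDivisibleGroup hp hg).transition_succ_right hnm, Category.assoc, h, ih]

/-- **BOOKKEEPING `(Fix ε)₁ ↪ (Fix ε)ₙ ↪ A[pⁿ] ↪ A = (Fix ε)₁ ↪ A[p] ↪ A`**: the inclusion of the block into `A` is compatible with the block's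
transitions (§1 + the previous lemma). [cite: Tate1967, §2 (2.1)] -/
theorem transition_comp_fixBTGroupι_app_comp_torsionι {n m : ℕ} (hnm : n ≤ m) :
    (((isRingActionBT_pDivisibleGroupMap act hp hg).homOfCompatibleFamily a (sub_mem_span_pow hx hcop ha1 ha2)).fixBTGroup ((isRingActionBT_pDivisibleGroupMap act hp hg).homOfCompatibleFamily_idem a (sub_mem_span_pow hx hcop ha1 ha2) (mul_self_sub_mem_span_pow hx hcop ha1 ha2)) h₁ hrank).transition hnm ≫ (((isRingActionBT_pDivisibleGroupMap act hp hg).homOfCompatibleFamily a (sub_mem_span_pow hx hcop ha1 ha2)).fixBTGroupι ((isRingActionBT_pDivisibleGroupMap act hp hg).homOfCompatibleFamily_idem a (sub_mem_span_pow hx hcop ha1 ha2) (mul_self_sub_mem_span_pow hx hcop ha1 ha2)) h₁ hrank).app m ≫ A.torsionι (p ^ m) = (((isRingActionBT_pDivisibleGroupMap act hp hg).homOfCompatibleFamily a (sub_mem_span_pow hx hcop ha1 ha2)).fixBTGroupι ((isRingActionBT_pDivisibleGroupMap act hp hg).homOfCompatibleFamily_idem a (sub_mem_span_pow hx hcop ha1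 ha2) (mul_self_sub_mem_span_pow hx hcop ha1 ha2)) h₁ hrank).app n ≫ A.torsionι (p ^ n) := by
  rw [← Category.assoc, ← BTGroup.Hom.app_comp_transition, Category.assoc, pDivisibleGroup_transition_comp_torsionι]

-- as in ★ (FKw) ∕ ★ K1: statements of the shape `s ≫ F_q = 1` need the slow `One (T ⟶ G^{(q)})` instance search through the transported structure.
set_option synthInstance.maxHeartbeats 400000 in
/-- **THE RELATIVE FROBENIUS OF `A` RESTRICTS TO THAT OF THE BLOCK LAYER** (layer criterion, ★ K1 `comp_comp_relFrobeniusOver_eq_one_iff_unit` + ★ (FKw)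
`comp_relFrobeniusOver_eq_one_iff_unit` along the monomorphic homomorphism `(Fix ε)ₙ ↪ A[pⁿ] ↪ A`): for a `T`-point `s` of `(Fix ε)ₙ`,
`(s ≫ ιₙ ≫ (A[pⁿ] ↪ A)) ≫ F^{(t)}_{A∕k} = 1 ↔ s ≫ F^{(t)}_{(Fix ε)ₙ∕k} = 1`. [cite: SGA3I, VII_A 4.1] [cite: GortzWedhorn2020, Definition 4.45 (2) (p. 117)] -/
theorem comp_comp_relFrobeniusOver_eq_one_iff_block [ExpChar k p] (f n : ℕ) {T : Over (Spec (.of k))} (s : T ⟶ (((isRingActionBT_pDivisibleGroupMap act hp hg).homOfCompatibleFamily a (sub_mem_span_pow hx hcop ha1 ha2)).fixBTGroup ((isRingActionBT_pDivisibleGroupMap act hp hg).homOfCompatibleFamily_idem a (sub_mem_span_pow hx hcop ha1 ha2) (mul_self_sub_mem_span_pow hx hcop ha1 ha2)) h₁ hrank).G n) :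
    (s ≫ (((isRingActionBT_pDivisibleGroupMap act hp hg).homOfCompatibleFamily a (sub_mem_span_pow hx hcop ha1 ha2)).fixBTGroupι ((isRingActionBT_pDivisibleGroupMap act hp hg).homOfCompatibleFamily_idem a (sub_mem_span_pow hx hcop ha1 ha2) (mul_self_sub_mem_span_pow hx hcop ha1 ha2)) h₁ hrank).app n ≫ A.torsionι (p ^ n)) ≫ relFrobeniusOver p f A.X = 1 ↔
      (letI := (((isRingActionBT_pDivisibleGroupMap act hp hg).homOfCompatibleFamily a (sub_mem_span_pow hx hcop ha1 ha2)).fixBTGroup ((isRingActionBT_pDivisibleGroupMap act hp hg).homOfCompatibleFamily_idem a (sub_mem_span_pow hx hcop ha1 ha2) (mul_self_sub_mem_span_pow hx hcop ha1 ha2)) h₁ hrank).grpObj n; s ≫ relFrobeniusOver p f ((((isRingActionBT_pDivisibleGroupMap act hp hg).homOfCompatibleFamily a (sub_mem_span_pow hx hcop ha1 ha2)).fixBTGroup ((isRingActionBT_pDivisibleGroupMap act hp hg).homOfCompatibleFamily_idem a (sub_mem_span_pow hx hcop ha1 ha2) (mul_self_sub_mem_span_pow hx hcop ha1 ha2)) h₁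 hrank).G n) = 1) := by
  letI := (((isRingActionBT_pDivisibleGroupMap act hp hg).homOfCompatibleFamily a (sub_mem_span_pow hx hcop ha1 ha2)).fixBTGroup ((isRingActionBT_pDivisibleGroupMap act hp hg).homOfCompatibleFamily_idem a (sub_mem_span_pow hx hcop ha1 ha2) (mul_self_sub_mem_span_pow hx hcop ha1 ha2)) h₁ hrank).grpObj n
  letI := (A.pDivisibleGroup hp hg).grpObj n
  haveI : IsMonHom ((((isRingActionBT_pDivisibleGroupMap act hp hg).homOfCompatibleFamily a (sub_mem_span_pow hx hcop ha1 ha2)).fixBTGroupι ((isRingActionBT_pDivisibleGroupMap act hp hg).homOfCompatibleFamily_idem a (sub_mem_span_pow hx hcop ha1 ha2) (mul_self_sub_mem_span_pow hx hcop ha1 ha2)) h₁ hrank).app n ≫ A.torsionι (p ^ n)) :=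
    isMonHom_comp_of_isMonHom' ((((isRingActionBT_pDivisibleGroupMap act hp hg).homOfCompatibleFamily a (sub_mem_span_pow hx hcop ha1 ha2)).fixBTGroupι ((isRingActionBT_pDivisibleGroupMap act hp hg).homOfCompatibleFamily_idem a (sub_mem_span_pow hx hcop ha1 ha2) (mul_self_sub_mem_span_pow hx hcop ha1 ha2)) h₁ hrank).isMonHom_app n) (A.isMonHom_torsionι (p ^ n))
  haveI : Mono ((((isRingActionBT_pDivisibleGroupMap act hp hg).homOfCompatibleFamily a (sub_mem_span_pow hx hcop ha1 ha2)).fixBTGroupι ((isRingActionBT_pDivisibleGroupMap act hp hg).homOfCompatibleFamily_idem a (sub_mem_span_pow hx hcop ha1 ha2) (mul_self_sub_mem_span_pow hx hcop ha1 ha2)) h₁ hrank).app n) := ((isRingActionBT_pDivisibleGroupMap act hp hg).homOfCompatibleFamily a (sub_mem_span_pow hx hcop ha1 ha2)).mono_fixLayerι n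
  haveI : @Mono _ _ ((A.pDivisibleGroup hp hg).G n) A.X (A.torsionι (p ^ n)) := A.mono_torsionι (p ^ n)
  haveI : Mono ((((isRingActionBT_pDivisibleGroupMap act hp hg).homOfCompatibleFamily a (sub_mem_span_pow hx hcop ha1 ha2)).fixBTGroupι ((isRingActionBT_pDivisibleGroupMap act hp hg).homOfCompatibleFamily_idem a (sub_mem_span_pow hx hcop ha1 ha2) (mul_self_sub_mem_span_pow hx hcop ha1 ha2)) h₁ hrank).app n ≫ A.torsionι (p ^ n)) := mono_comp _ _
  exact (comp_comp_relFrobeniusOver_eq_one_iff_unit p f ((((isRingActionBT_pDivisibleGroupMap act hp hg).homOfCompatibleFamily a (sub_mem_span_pow hx hcop ha1 ha2)).fixBTGroupι ((isRingActionBT_pDivisibleGroupMap act hp hg).homOfCompatibleFamily_idem a (sub_mem_span_pow hx hcop ha1 ha2) (mul_self_sub_mem_span_pow hx hcop ha1 ha2)) h₁ hrank).app n ≫ A.torsionι (p ^ n)) s).trans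
    (comp_relFrobeniusOver_eq_one_iff_unit p f s).symm

end ASide

/-! ## §4 HEAD — Frobenius saturation of the `w`-block in `A`-currency, binders of ★ P6d `blockDocking_of_line` verbatim -/

section Head

variable {k : Type u} [Field k] [IsAlgClosed k] (p f : ℕ) [hpr : Fact p.Prime] [CharP k p] [ExpChar k p]
  {A : AbelianSchemeOver (Spec (.of k))} [IsCommMonObj A.X] {g : ℕ} (hg : A.IsOfRelDim g)
  {O : Type v} [CommRing O] [IsDedekindDomain O] (act : RingAction O A)
  (w : Ideal O) [w.IsMaximal] (hw0 : w ≠ ⊥) (hpw : (p : O) ∈ w) (hf : Nat.card (O ⧸ w) = p ^ f)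
  {e : ℕ} {𝔟 : Ideal O} (he : 0 < e) (hx : Ideal.span {(p : O)} = w ^ e * 𝔟) (hcop : w ⊔ 𝔟 = ⊤)
  (a : ℕ → O) (ha1 : ∀ n, a n - 1 ∈ w ^ (e * n)) (ha2 : ∀ n, a n ∈ 𝔟 ^ n)
  -- SOCKET (S-H): the `w`-block has height `2ef`
  (hrank : ∀ n (s : Spec (.of k)),
    (((isRingActionBT_pDivisibleGroupMap act hpr.out.ne_zero hg).homOfCompatibleFamily a
      (sub_mem_span_pow hx hcop ha1 ha2)).fixLayer n).hom.finrank s = p ^ (n * (2 * e * f)))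
  -- SOCKET (S-T): the Lie signature of `e_w` on `A` is `1`
  (hsig : ∀ n, 0 < n → haveI := act.isMonHom_i (a n);
    Module.finrank k (LinearMap.range (cotangentMap A.toAffine.toAbelianVariety
      (InducedCategory.homMk (Grp.ofHom (A := A.X) (B := A.X) (act.i (a n)))))) = 1)

set_option synthInstance.maxHeartbeats 400000 in
set_option maxHeartbeats 800000 in
include hw0 hpw hf he hrank hsig in
/-- **HEAD — FROBENIUS SATURATION OF A ONE-DIMENSIONAL BLOCK, IN `A`-CURRENCY** (binders of ★ P6d `blockDocking_of_line` VERBATIM).  For an abelian scheme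
`A → Spec k` (`k = k̄` of characteristic `p`, commutative group law, relative dimension `g`) with a ring action `act` of a Dedekind domain `O`, a maximal
ideal `w ∋ p` with `#(O ⧸ w) = p^f`, `(p) = w^e 𝔟`, `w + 𝔟 = O`, `e > 0`, a block idempotent family `a` at `w`, the block height socket (S-H) `hrank` and the
Lie-signature socket (S-T) `hsig` (Kottwitz signature `1` at `w`): **a `T`-point of `A` killed by `wⁿ` and by the `q`-Frobenius `F^{(f)}_{A∕k}` is killed by
`w`** — `Ker F_q ∩ A[w^∞] ⊆ A[w]`.  Proof: §3 puts the point on the `n`-th layer of the block `Fix ε_w` with `s ≫ F_q = 1`; ★ (O-DOCK) `exists_blockDocking`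
+ ★ DEAL 6 `htan_hdim_block_of_lieSignature` feed §2 `BTGroup.exists_fac_uniformizerKernel_of_comp_relFrobeniusOver_eq_one`, which puts it in
`G = (Fix ε_w)₁[ϖ]`; ★ (O-DOCK) `hkerA` reads `G`-points as `w`-torsion points.  (Discharges the binder `hsat` of the L3 roof law at a special point, after
instantiation at `A := 𝒜_x̄`, `w := 𝔭_{c•w}` by the spine's socket dischargers.) [cite: Liu2021, Appendix D p. 137] [cite: Tate1967, §2.2 and (2.4)]
[cite: HarrisTaylorAMS2001, §II.1 p. 59, §II.2] [cite: RapoportSmithlingZhang2020Diagonal, §4.1 (p. 17)] [cite: SGA3I, VII_A 4.1–4.3] -/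
theorem forall_comp_i_eq_one_of_forall_mem_pow_of_comp_relFrobeniusOver_eq_one
    (n : ℕ) ⦃T : Over (Spec (.of k))⦄ (x : T ⟶ A.X) (hxw : ∀ b ∈ w ^ n, x ≫ act.i b = 1)
    (hxF : x ≫ relFrobeniusOver p f A.X = 1) :
    ∀ b ∈ w, x ≫ act.i b = 1 := by
  have hp : p.Prime := hpr.out
  -- `n = 0`: `x = x ≫ act.i 1 = 1`
  rcases Nat.eq_zero_or_pos n with rfl | hn
  · have h1 : x = 1 := by
      have h := hxw 1 (by rw [pow_zero, Ideal.one_eq_top]; exact Submodule.mem_top)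
      rwa [act.i_one, Category.comp_id] at h
    intro b _
    haveI := act.isMonHom_i b
    rw [h1, MonObj.one_comp]
  -- 𝒪-numerics of `𝒪 := O_w` (★ (O-CRT) §4 + Mathlib), as in ★ P6d `blockDocking_of_line`
  haveI : IsDiscreteValuationRing (Localization.AtPrime w) :=
    IsLocalization.AtPrime.isDiscreteValuationRing_of_dedekind_domain O hw0 _
  haveI : Finite (O ⧸ w) := Nat.finite_of_card_ne_zero (by rw [hf]; exact pow_ne_zero _ hp.ne_zero)
  haveI : Finite (IsLocalRing.ResidueField (Localization.AtPrime w)) := finite_residueField_localizationAtPrime w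
  have hq : Nat.card (IsLocalRing.ResidueField (Localization.AtPrime w)) = p ^ f :=
    natCard_residueField_localizationAtPrime_eq_pow w hf
  obtain ⟨ϖ, hϖ, hpe⟩ := associated_pow_natCast w hw0 p hx hcop
  have hϖmax : IsLocalRing.maximalIdeal (Localization.AtPrime w) = Ideal.span {ϖ} := hϖ.maximalIdeal_eq
  -- ★ (O-DOCK): the block `Bw`, its `O_w`-action, `G := Ker (βw ϖ)₁` and the `A`-side reading
  obtain ⟨βw, hβw, -, -, ⟨hGc, hGaff, hGfin⟩, hker, -, -, -, -, -, hkerA, -⟩ :=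
    exists_blockDocking hp.ne_zero hg act w hx hcop a ha1 ha2 (2 * e * f) hrank he hpw ϖ hϖmax
  letI := ((((isRingActionBT_pDivisibleGroupMap act hp.ne_zero hg).homOfCompatibleFamily a
      (sub_mem_span_pow hx hcop ha1 ha2)).fixBTGroup ((isRingActionBT_pDivisibleGroupMap act hp.ne_zero hg).homOfCompatibleFamily_idem a
      (sub_mem_span_pow hx hcop ha1 ha2) (mul_self_sub_mem_span_pow hx hcop ha1 ha2)) (2 * e * f) hrank).grpObj 1)
  haveI := (βw ϖ).isMonHom_app 1
  haveI := hGaff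
  haveI := hGfin
  -- ★ DEAL 6: the tangent tokens of the block from the Lie signature
  obtain ⟨htan, hdim⟩ := htan_hdim_block_of_lieSignature (hp := hp.ne_zero) (hg := hg) (act := act) (w := w) (hx := hx)
    (hcop := hcop) (a := a) (ha1 := ha1) (ha2 := ha2) (h₁ := 2 * e * f) (hrank := hrank) hsig
  -- §3: the point on the `n`-th layer of the block, killed by the block's `F_q`
  obtain ⟨s, hs⟩ := exists_comp_fixBTGroupι_app_comp_torsionι_of_forall_mem_pow hp.ne_zero hg act w hx hcop a ha1 ha2 (2 * e * f) hrank
    he hpw n x hxw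
  have hsF := (comp_comp_relFrobeniusOver_eq_one_iff_block hp.ne_zero hg act w hx hcop a ha1 ha2 (2 * e * f) hrank f n s).mp
    (by rw [hs]; exact hxF)
  -- §2: it lies in `G = (Fix ε)₁[ϖ]`
  obtain ⟨g', hg'⟩ := BTGroup.exists_fac_uniformizerKernel_of_comp_relFrobeniusOver_eq_one p f (Localization.AtPrime w) hq ϖ hϖ e he hpe
    _ βw hβw htan hdim (ker ((βw ϖ).app 1)) (kerι ((βw ϖ).app 1)) ⟨inferInstance, hGc⟩ hker hn s hsF
  -- ★ (O-DOCK) `hkerA`: `G`-points are `w`-torsion points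
  refine (hkerA x).mpr ⟨g', ?_⟩
  rw [← hs, ← hg', Category.assoc, Category.assoc,
    transition_comp_fixBTGroupι_app_comp_torsionι hp.ne_zero hg act w hx hcop a ha1 ha2 (2 * e * f) hrank hn]

end Head

end Literature.AlgebraicGeometry.AbelianSchemes.AbelianSchemeOver.RingAction

end
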